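import Mathlib
import HarnessLib
import Summits.HubbardSuperconductivity.HubbardSuperconductivity.Theorems.KLProgrammeC4aLevelChartImage
import Summits.HubbardSuperconductivity.HubbardSuperconductivity.Theorems.KLProgrammeC4aLoopAlignmentSheets
import Summits.HubbardSuperconductivity.HubbardSuperconductivity.Theorems.KLProgrammeC4aLatticeTubeSum

/-!
# Route `KLProgramme` — crux C4a, S3 brick (B4)/(B5) «(B4)-DIRECT-PACK», part 1: the partner of a loop point IS a chart point on some sheet —
# the `(e′, ψ, hP)` binders of the loop-alignment rows eliminated in favour of the partner LEVEL `ē`, uniformly over the sheets `2πℤ²`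

Cell `gate-hubbard-kl`, seat hubbard-kl-k3c3-p3 (g27; row «implicit-function / monotonicity route for μ(n)»).  Located brick for the (C)-closer lane
hubbard-kl-c4a-1 (stub (C) `stub_twoLeg_curvature` of `KLRegimeEngineV17F2`, stmt-HubbardSuperconductivity-20437), HOME/hubbard-kl-k3c3-p3/B4-ABS-BUBBLE.md §3
STILL-OPEN ROW (r4) «partner-in-tube ⇒ chart point» and memo B4-DIRECT-PACK.md.

The rows of `…C4aLoopAlignment(Sheets)` / `…C4aAbsBubbleRows` are stated for a loop point `Φ(e,φ+θ)` of the co-moving pp loop whose partner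
`P := S − Φ(e,φ+θ)` (`S = Φ(0,θ) + Φ(ρ,ϑ+θ)`) is GIVEN as a chart point `Φ(e′,ψ) + v` (`v` a period).  This file removes that datum (implicit-function step):
* §1 **zone reduction and the chart point**: every `q : Momentum` is within `π` (coordinatewise) of a lattice vector `2πm`; on the analysis window the scale tube
  `{|e_K| < r}` never meets the zone boundary (`|q_i| = π ⇒ e_K(q) ≥ −A − μ > r`), so (`levelChart_image`, c4a-1) **`exists_levelPoint_add_period_of_abs_frameLevel_lt`**:
  `|e_K(P)| < r ⇒ P = Φ(e_K(P), ψ) + 2πm` for some `ψ ∈ (−π,π]`, `m ∈ ℤ²` — the partner is the chart point OF ITS OWN LEVEL `ē = e_K(P)` on some sheet; on the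
  direct sheet (`|P_i| < π`) `m = 0` (`exists_levelPoint_eq_of_abs_frameLevel_lt`).
* §2 **the sheet-uniform relative first-order dichotomy row** `abs_deriv_partnerBand_pp_angle_gt_of_sheets`: for thresholds `(λ, ε)` with `|ē − e| ≤ ε`, if for EVERY sheet
  `m` the configuration is not `(λ,ε)`-Cooper relative to `2πm` (`msD₁τ(λ,ε) + ε/(Dt−2A) < ‖S − 2πm‖`) and the loop point is not in the `m`-th tangency corner / umklapp
  caustic (`msD₁τ(λ,ε) + (2|e|+ε)/(Dt−2A) < ‖S − 2πm − 2Φ(0,φ+θ)‖`), then `λ < |∂_φē|` — `loopAlignment_dichotomy_sheet` (g19) at the partner's own chart point.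
  Only the sheets `‖m‖_∞ ≤ 1` are ever active (part 2 discharges the others and, for `m ≠ 0`, the Cooper alternative); the closer's residual datum is CAUSTIC AVOIDANCE.
Pure bookkeeping/calculus on landed objects (binder shape = `…C4aLoopAlignment`); nothing about the model's sizes; nothing asserts (C), K3 or superconductivity.
References: FST II CPAM 51 (1998) §2.1 (the coordinates `e(p(ρ,θ)) = ρ`), §3 [cite: FeldmanSalmhoferTrubowitz1998]; BGM 2003 §7.1 Lemma 7.1 (A1.9)
[cite: BenfattoGiulianiMastropietro2003]; BGM 2006 §2.4 (2.40) [cite: BenfattoGiulianiMastropietro2006].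
-/

noncomputable section

namespace Summit.HubbardSuperconductivity.HubbardSuperconductivity.Theorems.C4a

set_option linter.dupNamespace false -- summit = problem name (single-conjunct summit), D-0017

open Real Set
open Literature.MathematicalPhysics.QuantumLattice Literature.MathematicalPhysics.QuantumLattice.BandSectorCounting
open Literature.MathematicalPhysics.QuantumLattice.FermiRG
open Summit.HubbardSuperconductivity.HubbardSuperconductivity.Theorems.KLRegimeSplit
open Summit.HubbardSuperconductivity.HubbardSuperconductivity.Theorems.DispersionFlow
open Summit.HubbardSuperconductivity.HubbardSuperconductivity.Theorems.PerturbedFermiCurve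

/-! ## §1 Zone reduction; the tube avoids the zone boundary; the partner is a chart point on some sheet -/

/-- Every real number is within `π` of an integer multiple of `2π`. -/
theorem exists_int_abs_sub_two_pi_mul_le (x : ℝ) : ∃ m : ℤ, |x - 2 * π * m| ≤ π := by
  refine ⟨round (x / (2 * π)), ?_⟩
  have h := abs_sub_round (x / (2 * π))
  have hπ : 0 < 2 * π := by positivity
  have e : x - 2 * π * (round (x / (2 * π)) : ℝ) = 2 * π * (x / (2 * π) - round (x / (2 * π))) := by
    field_simp
  rw [e, abs_mul, abs_of_pos hπ]
  nlinarith [Real.pi_pos]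

/-- **Zone reduction**: every momentum is, coordinatewise, within `π` of a lattice vector `2πm`, `m ∈ ℤ²`. -/
theorem exists_reduction_twoPi (q : Momentum) : ∃ m : Fin 2 → ℤ, ∀ i, |q i - 2 * π * (m i : ℝ)| ≤ π := by
  choose m hm using fun i => exists_int_abs_sub_two_pi_mul_le (q i)
  exact ⟨m, hm⟩

/-- The frame band is `2πℤ²`-periodic on `Momentum`: `e_K(q − 2πm) = e_K(q)`. -/
theorem frameLevel_sub_twoPi (μ : ℝ) (K : TrigPolyC4v) (q : Momentum) (m : Fin 2 → ℤ) :
    frameLevel μ K (q - WithLp.toLp 2 (fun i => 2 * π * (m i : ℝ))) = frameLevel μ K q := by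
  have h := TorusFourierL2.frameLevel_toLp_periodic μ K (fun i => q i - 2 * π * (m i : ℝ)) m
  have e1 : (WithLp.toLp 2 fun i => q i - 2 * π * (m i : ℝ) + 2 * π * (m i : ℝ)) = q := by
    ext i; simp
  have e2 : (WithLp.toLp 2 fun i => q i - 2 * π * (m i : ℝ)) = q - WithLp.toLp 2 (fun i => 2 * π * (m i : ℝ)) := by
    ext i; simp
  rw [e1, e2] at h
  exact h.symm

/-- The frame band is `2πℤ²`-periodic on `Momentum`: `e_K(q + 2πm) = e_K(q)` (the `hv` of `…C4aLoopAlignmentSheets`). -/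
theorem frameLevel_add_twoPi (μ : ℝ) (K : TrigPolyC4v) (m : Fin 2 → ℤ) (q : Momentum) :
    frameLevel μ K (q + WithLp.toLp 2 (fun i => 2 * π * (m i : ℝ))) = frameLevel μ K q := by
  have h := frameLevel_sub_twoPi μ K (q + WithLp.toLp 2 (fun i => 2 * π * (m i : ℝ))) m
  rw [add_sub_cancel_right] at h
  exact h.symm

section Band

variable {a b : ℝ} (B : BandBounds a b) {K : TrigPolyC4v} {A : ℝ}
  (hA : ∀ p : Momentum, ∀ j ≤ 2, ‖iteratedFDeriv ℝ j (frameShift K) p‖ ≤ A) (hADt : 2 * A < B.Dtmin)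
  {μ r : ℝ} (hlo : a ≤ μ - r - A) (hhi : μ + r + A ≤ b)
include B hA hADt hlo hhi

omit hADt hlo in
/-- **The scale tube never meets the zone boundary**: a point of the closed zone with a coordinate of modulus `π` has `e_K ≥ −A − μ ≥ r − b > r`
(`b < 0`); hence `|e_K(q)| < r`, `|q_i| ≤ π` force `|q_i| < π` — the tube lies in the OPEN zone. -/
theorem abs_apply_lt_pi_of_abs_frameLevel_lt {k : Fin 2 → ℝ} (hk : ∀ i, |k i| ≤ π) (hr : |frameLevel μ K (WithLp.toLp 2 k)| < r) (i : Fin 2) :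
    |k i| < π := by
  refine lt_of_le_of_ne (hk i) fun heq => ?_
  have hb := B.hb
  have hcos : Real.cos (k i) = -1 := by rw [← Real.cos_abs, heq, Real.cos_pi]
  have hsq : (0 : ℝ) ≤ sqDispersion k := by
    have hi : i = 0 ∨ i = 1 := by
      rcases i with ⟨i, hi⟩
      have : i = 0 ∨ i = 1 := by omega
      rcases this with rfl | rfl
      · exact Or.inl rfl
      · exact Or.inr rfl
    unfold sqDispersion
    rcases hi with rfl | rfl
    · have := Real.cos_le_one (k 1); rw [hcos]; linarith
    · have := Real.cos_le_one (k 0); rw [hcos]; linarith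
  have hfs : -A ≤ frameShift K (WithLp.toLp 2 k) := (abs_le.1 (abs_frameShift_toLp_le hA k)).1
  have hval := frameLevel_toLp μ K k
  have hlt := (abs_lt.1 hr).2
  linarith

omit B hADt hlo in
/-- **Quantitative version** (the margin used by part 2 to discharge the umklapp sheets): if moreover `b ≤ −9/100` then a closed-zone point with
`|e_K| < r` has every coordinate of modulus `< π − 3/10` (`|q_i| ≥ π − 3/10 ⇒ cos q_i ≤ −cos(3/10) ≤ −191/200 ⇒ e_K ≥ −9/100 − A − μ ≥ r`). -/
theorem abs_apply_lt_pi_sub_of_abs_frameLevel_lt (hb9 : b ≤ -(9 / 100)) {k : Fin 2 → ℝ} (hk : ∀ i, |k i| ≤ π)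
    (hr : |frameLevel μ K (WithLp.toLp 2 k)| < r) (i : Fin 2) : |k i| < π - 3 / 10 := by
  by_contra hcon
  push Not at hcon
  -- `cos (k i) ≤ cos (π − 3/10) = −cos (3/10) ≤ −(1 − (3/10)²/2)`
  have hcos : Real.cos (k i) ≤ -(191 / 200) := by
    have h1 : Real.cos (k i) = Real.cos |k i| := (Real.cos_abs _).symm
    have h2 : Real.cos |k i| ≤ Real.cos (π - 3 / 10) :=
      Real.cos_le_cos_of_nonneg_of_le_pi (by linarith [Real.pi_gt_three]) (hk i) hcon
    have h3 : Real.cos (π - 3 / 10) = -Real.cos (3 / 10) := Real.cos_pi_sub _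
    have h4 : 1 - (3 / 10 : ℝ) ^ 2 / 2 ≤ Real.cos (3 / 10) := Real.one_sub_sq_div_two_le_cos
    rw [h1]; linarith
  have hsq : -(9 / 100 : ℝ) ≤ sqDispersion k := by
    have hi : i = 0 ∨ i = 1 := by
      rcases i with ⟨i, hi⟩
      have : i = 0 ∨ i = 1 := by omega
      rcases this with rfl | rfl
      · exact Or.inl rfl
      · exact Or.inr rfl
    unfold sqDispersion
    rcases hi with rfl | rfl
    · have := Real.cos_le_one (k 1); linarith
    · have := Real.cos_le_one (k 0); linarith
  have hfs : -A ≤ frameShift K (WithLp.toLp 2 k) := (abs_le.1 (abs_frameShift_toLp_le hA k)).1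
  have hval := frameLevel_toLp μ K k
  have hlt := (abs_lt.1 hr).2
  linarith

/-- **THE PARTNER IS A CHART POINT ON SOME SHEET** (implicit-function step, row (r4)): every momentum `P` in the scale tube `|e_K(P)| < r` of the analysis
window is `P = Φ(e_K(P), ψ) + 2πm` for some angle `ψ ∈ (−π, π]` and lattice vector `m ∈ ℤ²` — the chart point OF ITS OWN LEVEL on the sheet `m`.
[cite: FeldmanSalmhoferTrubowitz1998, §2.1] -/
theorem exists_levelPoint_add_period_of_abs_frameLevel_lt {P : Momentum} (hP : |frameLevel μ K P| < r) :
    ∃ (m : Fin 2 → ℤ) (ψ : ℝ), ψ ∈ Ioc (-π) π ∧ P = levelPoint μ K (frameLevel μ K P) ψ + WithLp.toLp 2 (fun i => 2 * π * (m i : ℝ)) := by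
  obtain ⟨m, hm⟩ := exists_reduction_twoPi P
  set k : Fin 2 → ℝ := fun i => P i - 2 * π * (m i : ℝ) with hk
  have hPk : P - WithLp.toLp 2 (fun i => 2 * π * (m i : ℝ)) = WithLp.toLp 2 k := by ext i; simp [hk]
  have hlev : frameLevel μ K (WithLp.toLp 2 k) = frameLevel μ K P := by rw [← hPk, frameLevel_sub_twoPi]
  have hkr : |frameLevel μ K (WithLp.toLp 2 k)| < r := by rw [hlev]; exact hP
  have hki : ∀ i, |k i| ≤ π := fun i => by simpa [hk] using hm i
  have hopen := abs_apply_lt_pi_of_abs_frameLevel_lt B hA hhi hki hkr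
  -- `(k 0, k 1)` is in the tube of the open square: a chart point
  have hmem : ((k 0, k 1) : ℝ × ℝ) ∈ {q : ℝ × ℝ | |q.1| < π ∧ |q.2| < π ∧ |frameLevel μ K (WithLp.toLp 2 ![q.1, q.2])| < r} := by
    refine ⟨hopen 0, hopen 1, ?_⟩
    have e : (![k 0, k 1] : Fin 2 → ℝ) = k := by funext j; fin_cases j <;> rfl
    simp only [e]; exact hkr
  rw [← levelChart_image B hA hADt hlo hhi] at hmem
  obtain ⟨p, hp, hpk⟩ := hmem
  have hψ : p.2 ∈ Ioc (-π) π := (mem_prod.1 hp).2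
  have hp1 : p.1 ∈ Ioo (-r) r := (mem_prod.1 hp).1
  -- the chart point is `toLp k`
  have hpt : levelPoint μ K p.1 p.2 = WithLp.toLp 2 k := by
    rw [← toLp_vec_levelChart, hpk]
    congr 1; funext j; fin_cases j <;> rfl
  -- its level is `e_K(P)`
  have hρ : p.1 = frameLevel μ K P := by
    have h := frameLevel_levelPoint B hA (μ := μ) (ρ := p.1) (by linarith [hp1.1]) (by linarith [hp1.2]) p.2
    rw [hpt, hlev] at h
    exact h.symm
  refine ⟨m, p.2, hψ, ?_⟩
  rw [← hρ, hpt, ← hPk, sub_add_cancel]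

/-- **Direct sheet**: a tube momentum of the OPEN zone is the chart point of its own level, `P = Φ(e_K(P), ψ)`. -/
theorem exists_levelPoint_eq_of_abs_frameLevel_lt {P : Momentum} (hP : |frameLevel μ K P| < r) (hsq : ∀ i, |P i| < π) :
    ∃ ψ : ℝ, ψ ∈ Ioc (-π) π ∧ P = levelPoint μ K (frameLevel μ K P) ψ := by
  have hmem : ((P 0, P 1) : ℝ × ℝ) ∈ {q : ℝ × ℝ | |q.1| < π ∧ |q.2| < π ∧ |frameLevel μ K (WithLp.toLp 2 ![q.1, q.2])| < r} := by
    refine ⟨hsq 0, hsq 1, ?_⟩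
    have e : (WithLp.toLp 2 ![P 0, P 1] : Momentum) = P := by ext j; fin_cases j <;> rfl
    simp only [e]; exact hP
  rw [← levelChart_image B hA hADt hlo hhi] at hmem
  obtain ⟨p, hp, hpk⟩ := hmem
  have hp1 : p.1 ∈ Ioo (-r) r := (mem_prod.1 hp).1
  have hpt : levelPoint μ K p.1 p.2 = P := by
    rw [← toLp_vec_levelChart, hpk]
    ext j; fin_cases j <;> rfl
  have hρ : p.1 = frameLevel μ K P := by
    have h := frameLevel_levelPoint B hA (μ := μ) (ρ := p.1) (by linarith [hp1.1]) (by linarith [hp1.2]) p.2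
    rw [hpt] at h; exact h.symm
  exact ⟨p.2, (mem_prod.1 hp).2, by rw [← hρ, hpt]⟩

end Band

/-! ## §2 The sheet-uniform relative first-order dichotomy row for the partner band -/

section Sizes

variable {K : TrigPolyC4v} {A : ℝ} (hA : ∀ p : Momentum, ∀ j ≤ 2, ‖iteratedFDeriv ℝ j (frameShift K) p‖ ≤ A) (hA20 : A ≤ 1 / 20)
  (hd : klCurveD ≤ (bandBounds (show (-4 : ℝ) < -1.1 by norm_num) (show (-1.1 : ℝ) ≤ -0.1 by norm_num)
    (show (-0.1 : ℝ) < 0 by norm_num)).Dtmin - 2 * A)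
  {μ r : ℝ} (hr : 0 < r) (hlo : (-1.1 : ℝ) < μ - r - A) (hhi : μ + r + A < -0.1)
  {A₃ A₄ : ℝ} (hA₃ : ∀ p : Momentum, ‖iteratedFDeriv ℝ 3 (frameShift K) p‖ ≤ A₃)
  (hA₄ : ∀ p : Momentum, ‖iteratedFDeriv ℝ 4 (frameShift K) p‖ ≤ A₄)
include hA hA20 hd hr hlo hhi hA₃ hA₄

omit hA20 hr hA₃ hA₄ in
/-- **The partner of a loop point is a chart point on some sheet** (Sizes binder shape): with `S = Φ(0,θ) + Φ(ρ,ϑ+θ)` and `ē = e_K(S − Φ(e,φ+θ))`, if `|ē| < r`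
then `S − Φ(e,φ+θ) = Φ(ē, ψ) + 2πm` for some `ψ`, `m ∈ ℤ²`. -/
theorem exists_partner_pp_eq_levelPoint_add_period {ρ e : ℝ} {ϑ θ φ : ℝ}
    (hē : |frameLevel μ K (pairSumPath μ K ρ ϑ θ 0 - levelPoint μ K e (φ + θ))| < r) :
    ∃ (m : Fin 2 → ℤ) (ψ : ℝ), pairSumPath μ K ρ ϑ θ 0 - levelPoint μ K e (φ + θ) =
      levelPoint μ K (frameLevel μ K (pairSumPath μ K ρ ϑ θ 0 - levelPoint μ K e (φ + θ))) ψ + WithLp.toLp 2 (fun i => 2 * π * (m i : ℝ)) := by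
  have hADt : 2 * A < (bandBounds (show (-4 : ℝ) < -1.1 by norm_num) (show (-1.1 : ℝ) ≤ -0.1 by norm_num)
      (show (-0.1 : ℝ) < 0 by norm_num)).Dtmin := by have := klCurveD_pos; linarith
  obtain ⟨m, ψ, -, h⟩ := exists_levelPoint_add_period_of_abs_frameLevel_lt
    (bandBounds (show (-4 : ℝ) < -1.1 by norm_num) (show (-1.1 : ℝ) ≤ -0.1 by norm_num) (show (-0.1 : ℝ) < 0 by norm_num))
    hA hADt hlo.le hhi.le hē
  exact ⟨m, ψ, h⟩

omit hr in
/-- **THE SHEET-UNIFORM RELATIVE FIRST-ORDER DICHOTOMY ROW** (row (r4) of B4-ABS-BUBBLE §3: the `(e′,ψ,hP,heps)` data of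
`abs_deriv_partnerBand_pp_angle_gt_of_loopAlignment` eliminated).  Under clause (i) of `FrameOK` (`GeomConstants (frameLevel μ K) Kc r₀ g₀ w`), at a configuration
`(ρ,ϑ,θ)` and a loop point `(e,φ)` (`|e| < r`, `|e| < r₀`) whose partner level `ē = e_K(S − Φ(e,φ+θ))` satisfies `|ē| < r` and `|ē − e| ≤ ε`, let `λ ∈ ℝ` and
`τ(λ,ε) = ((π/2)λ/((Dt−2A)u_min) + πKcε/(Dt−2A)²)/(u_min·w/(4+2A))`.  If for EVERY sheet `m ∈ ℤ²` the configuration is not `(λ,ε)`-Cooper relative to `2πm`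
(`msD₁·τ + ε/(Dt−2A) < ‖S − 2πm‖`) and the loop point avoids the `m`-th tangency corner / umklapp caustic (`msD₁·τ + (2|e|+ε)/(Dt−2A) < ‖S − 2πm − 2Φ(0,φ+θ)‖`),
then `λ < |∂_φē|`. [cite: BenfattoGiulianiMastropietro2003, §7.1 Lemma 7.1 (A1.9)] -/
theorem abs_deriv_partnerBand_pp_angle_gt_of_sheets {Kc r₀ g₀ w : ℝ} (hG : GeomConstants (frameLevel μ K) Kc r₀ g₀ w) {ρ e : ℝ}
    (he : |e| < r) (he₀ : |e| < r₀) {ϑ θ φ : ℝ}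
    (hē : |frameLevel μ K (pairSumPath μ K ρ ϑ θ 0 - levelPoint μ K e (φ + θ))| < r) {lam eps : ℝ}
    (heps : |frameLevel μ K (pairSumPath μ K ρ ϑ θ 0 - levelPoint μ K e (φ + θ)) - e| ≤ eps)
    (hC : ∀ m : Fin 2 → ℤ, msD A₃ A₄ 1 *
            ((π / 2 * lam /
                  (((bandBounds (show (-4 : ℝ) < -1.1 by norm_num) (show (-1.1 : ℝ) ≤ -0.1 by norm_num) (show (-0.1 : ℝ) < 0 by norm_num)).Dtmin -
                      2 * A) *
                    (bandBounds (show (-4 : ℝ) < -1.1 by norm_num) (show (-1.1 : ℝ) ≤ -0.1 by norm_num) (show (-0.1 : ℝ) < 0 by norm_num)).umin) +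
                π * Kc * eps / ((bandBounds (show (-4 : ℝ) < -1.1 by norm_num) (show (-1.1 : ℝ) ≤ -0.1 by norm_num)
                  (show (-0.1 : ℝ) < 0 by norm_num)).Dtmin - 2 * A) ^ 2) /
              ((bandBounds (show (-4 : ℝ) < -1.1 by norm_num) (show (-1.1 : ℝ) ≤ -0.1 by norm_num) (show (-0.1 : ℝ) < 0 by norm_num)).umin * w /
                (4 + 2 * A))) +
          eps / ((bandBounds (show (-4 : ℝ) < -1.1 by norm_num) (show (-1.1 : ℝ) ≤ -0.1 by norm_num) (show (-0.1 : ℝ) < 0 by norm_num)).Dtmin - 2 * A) <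
        ‖pairSumPath μ K ρ ϑ θ 0 - WithLp.toLp 2 (fun i => 2 * π * (m i : ℝ))‖)
    (hT : ∀ m : Fin 2 → ℤ, msD A₃ A₄ 1 *
            ((π / 2 * lam /
                  (((bandBounds (show (-4 : ℝ) < -1.1 by norm_num) (show (-1.1 : ℝ) ≤ -0.1 by norm_num) (show (-0.1 : ℝ) < 0 by norm_num)).Dtmin -
                      2 * A) *
                    (bandBounds (show (-4 : ℝ) < -1.1 by norm_num) (show (-1.1 : ℝ) ≤ -0.1 by norm_num) (show (-0.1 : ℝ) < 0 by norm_num)).umin) +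
                π * Kc * eps / ((bandBounds (show (-4 : ℝ) < -1.1 by norm_num) (show (-1.1 : ℝ) ≤ -0.1 by norm_num)
                  (show (-0.1 : ℝ) < 0 by norm_num)).Dtmin - 2 * A) ^ 2) /
              ((bandBounds (show (-4 : ℝ) < -1.1 by norm_num) (show (-1.1 : ℝ) ≤ -0.1 by norm_num) (show (-0.1 : ℝ) < 0 by norm_num)).umin * w /
                (4 + 2 * A))) +
          (2 * |e| + eps) / ((bandBounds (show (-4 : ℝ) < -1.1 by norm_num) (show (-1.1 : ℝ) ≤ -0.1 by norm_num) (show (-0.1 : ℝ) < 0 by norm_num)).Dtmin -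
            2 * A) <
        ‖pairSumPath μ K ρ ϑ θ 0 - WithLp.toLp 2 (fun i => 2 * π * (m i : ℝ)) - (2 : ℝ) • levelPoint μ K 0 (φ + θ)‖) :
    lam < |deriv (fun x : ℝ => frameLevel μ K (pairSumPath μ K ρ ϑ θ 0 - levelPoint μ K e (x + θ))) φ| := by
  set B := bandBounds (show (-4 : ℝ) < -1.1 by norm_num) (show (-1.1 : ℝ) ≤ -0.1 by norm_num) (show (-0.1 : ℝ) < 0 by norm_num) with hBdef
  set e' := frameLevel μ K (pairSumPath μ K ρ ϑ θ 0 - levelPoint μ K e (φ + θ)) with he'def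
  obtain ⟨m, ψ, hP⟩ := exists_partner_pp_eq_levelPoint_add_period hA hd hlo hhi (ρ := ρ) (e := e) (ϑ := ϑ) (θ := θ) (φ := φ) hē
  rw [← he'def] at hP
  have hv : ∀ q : Momentum, frameLevel μ K (q + WithLp.toLp 2 (fun i => 2 * π * (m i : ℝ))) = frameLevel μ K q := frameLevel_add_twoPi μ K m
  by_contra hcon
  push Not at hcon
  -- the slope `ℓ` at the partner's own chart point
  have hℓ : |fderiv ℝ (frameLevel μ K) (levelPoint μ K e' ψ) (iteratedDeriv 1 (levelPoint μ K e) (φ + θ))| ≤ lam := by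
    have h := deriv_partnerBand_pp_angle_eq_neg_sheet hA hd hlo hhi hv he hP
    rw [h, abs_neg] at hcon
    exact hcon
  -- signs of the constants
  have hA0 : 0 ≤ A := (norm_nonneg _).trans (hA 0 0 (by norm_num))
  have hDt : 0 < B.Dtmin - 2 * A := by have := klCurveD_pos; linarith
  have hu : 0 < B.umin := B.umin_pos
  have hw : 0 < w := hG.wmin_pos
  have hcK : 0 < B.umin * w / (4 + 2 * A) := by positivity
  have hKc : 0 ≤ Kc := le_trans (norm_nonneg _) (hG.norm_iteratedFDeriv_le (0 : Momentum) 0 (by norm_num))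
  have hM : 0 ≤ msD A₃ A₄ 1 := (norm_nonneg _).trans (norm_iteratedDeriv_levelPoint_le hA hA20 hd hlo hhi hA₃ hA₄ he le_rfl (by norm_num) 0)
  -- monotonicity of `τ` in `(|ℓ|, |e′ − e|)`
  have hτ : msD A₃ A₄ 1 *
        ((π / 2 * |fderiv ℝ (frameLevel μ K) (levelPoint μ K e' ψ) (iteratedDeriv 1 (levelPoint μ K e) (φ + θ))| /
              ((B.Dtmin - 2 * A) * B.umin) + π * Kc * |e' - e| / (B.Dtmin - 2 * A) ^ 2) / (B.umin * w / (4 + 2 * A))) ≤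
      msD A₃ A₄ 1 * ((π / 2 * lam / ((B.Dtmin - 2 * A) * B.umin) + π * Kc * eps / (B.Dtmin - 2 * A) ^ 2) / (B.umin * w / (4 + 2 * A))) := by
    refine mul_le_mul_of_nonneg_left (div_le_div_of_nonneg_right (add_le_add ?_ ?_) hcK.le) hM
    · exact div_le_div_of_nonneg_right (mul_le_mul_of_nonneg_left hℓ (by positivity)) (by positivity)
    · exact div_le_div_of_nonneg_right (mul_le_mul_of_nonneg_left heps (by positivity)) (by positivity)
  have hee' : |e - e'| ≤ eps := by rw [abs_sub_comm]; exact heps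
  have hsum : |e| + |e'| ≤ 2 * |e| + eps := by
    have h1 : |e'| ≤ |e' - e| + |e| := by
      have := abs_add_le (e' - e) e
      rwa [sub_add_cancel] at this
    linarith
  rcases loopAlignment_dichotomy_sheet hA hA20 hd hlo hhi hA₃ hA₄ hG he hē he₀ hP with h | h
  · -- Cooper branch relative to the sheet `m`: contradicts `hC m`
    have h2 : |e - e'| / (B.Dtmin - 2 * A) ≤ eps / (B.Dtmin - 2 * A) := div_le_div_of_nonneg_right hee' hDt.le
    have h3 := hC m
    linarith
  · -- tangency corner / umklapp caustic of the sheet `m`: contradicts `hT m`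
    have h2 : (|e| + |e'|) / (B.Dtmin - 2 * A) ≤ (2 * |e| + eps) / (B.Dtmin - 2 * A) := div_le_div_of_nonneg_right hsum hDt.le
    have h3 := hT m
    linarith

end Sizes

end Summit.HubbardSuperconductivity.HubbardSuperconductivity.Theorems.C4a

end
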